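import Summits.BirchSwinnertonDyer.BirchSwinnertonDyer.Theorems.ByReductionTypeAtTwoSupersingularTwoAdicImageCriterion
import Summits.BirchSwinnertonDyer.BirchSwinnertonDyer.Theorems.ByReductionTypeAtTwoSupersingularCMTraceZeroAtTwo
import Literature.NumberTheory.EllipticCurves.Rank1Residual.Predicates
import Literature.NumberTheory.EllipticCurves.TateModuleTransvectionCriterionProofs
import Literature.NumberTheory.EllipticCurves.TwoAdicImageModFourArithmeticProofs
import Literature.NumberTheory.EllipticCurves.TateModuleBigImageOfSurjectiveProofs
import HarnessLib

/-!
# K81 — the Euler-system big-image hypothesis (im) at `p = 2` FAILS on the whole non-surjective good-supersingular locus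
(the level-4 transvection criterion; -imc g30, D-imc-81 at the Galois level)

Crux `SupersingularRankZeroAtTwo` (stmt-BirchSwinnertonDyer-19097), line `odd_blind_package`, stub 3
`stub_allMuFlatOfNonSurj : MuFlatOfNonSurjAtTwo`, habitat `GoodSS W 2 ∧ ¬ TwoAdicSurjective W` (= the Dokchitser–Dokchitser
family `j(E) = −4t³(t+8)`).

MAIN THEOREM `not_bigIm_two_of_goodSS_of_not_twoAdicSurjective`: for `E/ℚ` (globally minimal model) with good supersingular
reduction at `2` and `ρ_{E,2^∞}` NOT surjective, the tree's literal big-image predicate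
`Literature.NumberTheory.EllipticCurves.Rank1Residual.BigIm W 2` — "∃ σ ∈ Γ_ℚ fixing all 2-power roots of unity with
`T₂E ⧸ (ρ(σ) − 1)T₂E ≃ₗ[ℤ₂] ℤ₂`" = Burungale–Castella–Skinner (im) = Kato, Astérisque 295, Thm. 13.4 (3)'s `σ`
[corpus:paper:doi-10-24033-ast-639 p0111] = Rubin, *Euler Systems*, Hyp(ℚ_∞, T)(ii) = Kings–Loeffler–Zerbes Hyp(BI)(ii)
[corpus:paper:arxiv-1503.02888 p0091] — is FALSE.  Equivalently (`bigImTwoForcesTwoAdicSurjectiveOnGoodSS_holds`) the typed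
candidate K81-A of `K81GaloisLevel.lean` @6c20ff578417 HOLDS: on `GoodSS W 2`, (im) at `2` forces `TwoAdicSurjective W`.

The catalogued barrier `Literature/Barriers/BirchSwinnertonDyer/EulerSystemBigImageAtSmallImage`
(`WeierstrassCurve.isEmpty_quotient_range_galoisRepTate_sub_one_equiv`: `irr(p) ∧ ¬surj(p) ⟹ ¬(im)`, reduction MOD `p`) is vacuous
here — at a good supersingular `2` the MOD-2 image is all of `GL₂(𝔽₂)` (`SSTwoAdicImage.hasSurjectiveModNGaloisRep_two_of_goodSS_two`).
The present theorem is its analogue ONE LEVEL UP: reduction MOD 4.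

PROOF.  (1) `det ρ̄₄(σ) = 1`: `σ` fixes `ζ = e₄(P₀,Q₀)` (a primitive 4th root of unity, `LevelFour.zeta_sq`), and
`σζ = ζ^{det ρ̄₄(σ)}` (`LevelFour.smul_zeta`).  (2) Reduction of `Ψ : T/(σ−1)T ≃ ℤ₂` through `π₄ = TateModule.proj 2 2 : T₂E ↠ E[4]`
(kernel `4·T₂E`, `Γ_ℚ`-equivariant) — verbatim the argument of `TateModuleTransvectionCriterionProofs` with `p` replaced by
`p² = 4`: `E[4] ⧸ (σ−1)E[4]` is cyclic, generated by `x₀ = [π₄ t₀]`, and `m • x₀ = 0 ⟹ 4 ∣ m`.  (3) In the frame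
`LevelFour.frame4 : E[4] ≃+ (ℤ/4)²` (`rhoMat_mulVec`: `e(σP) = ρ̄₄(σ)·eP`) this says: `coker(ρ̄₄(σ) − 1)` on `(ℤ/4)²` is cyclic with
generator `v = e(π₄t₀)` and `v, 2v ∉ im(ρ̄₄(σ) − 1)`.  (4) LEVEL-4 SMITH COMPUTATION
(`trace_eq_two_and_par_ne_one_of_cyclic`, pure `ℤ/4`-algebra): with `det = 1` this forces `tr ρ̄₄(σ) = 2` (else
`det(ρ̄₄(σ) − 1) ∈ {2} ∪ (ℤ/4)^×` and the adjugate exhibits `2v` or `v` in the image) and `ρ̄₄(σ) ≢ 1 (mod 2)` (else the image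
is killed by `2` and `e₀, e₁` cannot both be `≡` multiples of `v`).  (5) Contradiction with the `τ`-OBSTRUCTION of
`D81TauObstructionAtTwo` (inlined §1): on `GoodSS W 2 ∧ ¬ TwoAdicSurjective W`, `Im ρ̄₄` is conjugate into D–D's `ℍ`, in which
`det = 1 ∧ tr = 2 ⟹ ≡ 1 (mod 2)`.

## References
* [Kato2004] K. Kato, Astérisque 295 (2004), Thm. 13.4 (3) (p. 226), (12.5.2) (p. 222).
* [BurungaleCastellaSkinner2025] A. Burungale, F. Castella, C. Skinner, IMRN 2025 = arXiv:2405.00270v2, p. 2 (im).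
* [KingsLoefflerZerbes2017] G. Kings, D. Loeffler, S. Zerbes, Camb. J. Math. 5 (2017) = arXiv:1503.02888, Hyp. (BI) §11.1.
* [DokchitserDokchitserMathZ2012] T. and V. Dokchitser, Math. Z. 272 (2012), 961–964, Lemma and Theorem (2).
* [Serre1972] J.-P. Serre, Invent. Math. 15 (1972), §2.4 Prop. 15 (transvections).
* [SilvermanAEC2009] J. H. Silverman, *AEC*, III.§7–§8.

**v2 (-imc g30, 2026-08-31T07:25Z) — §4 added; §1–§3 byte-identical to v1 @e3c68fced5d7; one import added
(`TateModuleBigImageOfSurjectiveProofs`).**  The converse K81-B and the equivalence K81-AB are now THEOREMS: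
`twoAdicSurjectiveGivesBigImTwo_holds` (any `E/ℚ`: `TwoAdicSurjective W → BigIm W 2`; = the tree theorem
`WeierstrassCurve.exists_quotient_range_galoisRepTate_sub_one_equiv_of_forall_surjective` of
`Literature/NumberTheory/EllipticCurves/TateModuleBigImageOfSurjectiveProofs` at `p = 2`, bridged to the cells' spellings; level
`1` supplied by `hasSurjectiveModNGaloisRep_one`), `bigImTwoIffTwoAdicSurjectiveOnGoodSS_holds` (on `GoodSS W 2`:
`BigIm W 2 ↔ TwoAdicSurjective W`) and the `j`-form `bigIm_two_iff_forall_j_ne_of_goodSS_two` (on `GoodSS W 2`: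
(im) at `2` ⟺ `∀ t : ℚ, j(E) ≠ −4t³(t+8)`).  So on the good-supersingular-at-2 locus the Euler-system hypothesis (im) at `2`
is DECIDED by the `j`-invariant.

**v3 (-imc g30, 2026-08-31T08:15Z) — §5 added; §1–§4 byte-identical to v2 @90c9399f74e3; no import change.**  K81-D
(«not even with defect 2») is a THEOREM: `natCard_quotient_range_sub_one_ne_eight` — for `E/ℚ` (globally minimal) good
supersingular at `2` with `ρ_{E,2^∞}` not onto and any `σ ∈ Γ_ℚ` fixing the fourth roots of unity, `#(E[4]/(σ−1)E[4]) ≠ 8`;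
hence `T₂E/(σ−1)T₂E ≇ ℤ₂ ⊕ ℤ/2` for `σ ∈ G_{ℚ(μ_{2^∞})}` (reduce mod `4`), and with K81 the MINIMAL DEFECT of a Chebotarev
element for an Euler-system argument at `2` on the D–D locus is `4` (attained by `σ ↦ (1 4; 0 1)` on the generic member,
whose 2-adic image is the full preimage of `ℍ`).  Kernel input: `HH_image_sub_one_ne_two` (`decide +kernel`): for the twelve
`det = 1` elements `h ∈ ℍ` the image of `h − 1` on `(ℤ/4)²` never has exactly two elements (`ℍ ∩ ker(→ GL₂(ℤ/2)) = 1 + 2·𝔽₄`).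
`noOrderEightCokernelAtLevelFourOnDD_holds` restates it in the shape of `K81GaloisLevel.NoOrderEightCokernelAtLevelFourOnDD`
(v3 @2728a58c390d).
-/

set_option autoImplicit false
set_option linter.dupNamespace false

noncomputable section

open scoped Classical
open Field

open Matrix WeierstrassCurve Literature.NumberTheory.EllipticCurves Literature.NumberTheory.EllipticCurves.Rank1Residual
open Literature.NumberTheory.GaloisRepresentations.GL2Mod4
open Literature.NumberTheory.GaloisRepresentations.GL2Mod8 (P4 P4.mul eps)
open Literature.NumberTheory.EllipticCurves.DokchitserDokchitser2012
open Summit.BirchSwinnertonDyer.Rank1Residual Summit.BirchSwinnertonDyer.Rank1Residual.X5.O1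
open Summit.BirchSwinnertonDyer.BirchSwinnertonDyer.Theorems

namespace Summit.BirchSwinnertonDyer.BirchSwinnertonDyer.Cruxes.SupersingularRankZeroAtTwo

namespace K81BigImLevelFour

/-! ## §1 Inlined from the crux workfile `D81TauObstructionAtTwo.lean` @67c49c81f22c (Cruxes modules are not importable on
the farm, `remote:stale:unbuilt`; statements and proofs verbatim) -/

set_option maxRecDepth 100000 in
set_option maxHeartbeats 0 in
/-- **In `ℍ`, `det h = 1 ∧ tr h = 2 ⟹ h ≡ 1 (mod 2)`** (the `12` elements of `ℍ ∩ SL₂(ℤ/4)` of trace `2` are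
`±1, ±(1 + 2w₀)`-type kernel elements). [cite: DokchitserDokchitserMathZ2012, proof of Theorem (2) (the subgroup ℍ)] -/
theorem HH_par_eq_one_of_det_eq_one_of_trace_eq_two :
    ∀ h ∈ HH, Q4.det h = 1 → h.1 + h.2.2.2 = 2 → Q4.par h = (1, 0, 0, 1) := by
  decide +kernel

/-! ## §2 `det`, `tr` and `≡ 1 (mod 2)` are conjugation invariants in `M₂(ℤ/4ℤ)` -/

/-- `P4.mul p 1̄ = p`. [folklore] -/
theorem P4_mul_one : ∀ p : P4, P4.mul p (1, 0, 0, 1) = p := by decide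

/-- `det (k m k⁻¹) = det m` for `det k ∈ (ℤ/4)^×`. [folklore] -/
theorem det_conj (k m : M4) (hk : k.det * k.det = 1) : (k * m * inv' k).det = m.det := by
  have e : k.det * (inv' k).det = 1 := by rw [← Matrix.det_mul, mul_inv' hk, Matrix.det_one]
  rw [Matrix.det_mul, Matrix.det_mul]
  linear_combination m.det * e

/-- `tr (k m k⁻¹) = tr m` for `det k ∈ (ℤ/4)^×`. [folklore] -/
theorem trace_conj (k m : M4) (hk : k.det * k.det = 1) : (k * m * inv' k).trace = m.trace := by
  rw [Matrix.trace_mul_cycle, inv'_mul hk, one_mul]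

/-- `k m k⁻¹ ≡ 1 (mod 2) ⟹ m ≡ 1 (mod 2)` for `det k ∈ (ℤ/4)^×`. [folklore] -/
theorem par_eq_one_of_par_conj_eq_one (k m : M4) (hk : k.det * k.det = 1)
    (h : par (k * m * inv' k) = (1, 0, 0, 1)) : par m = (1, 0, 0, 1) := by
  have e : m = inv' k * (k * m * inv' k) * k := by
    rw [← mul_assoc, ← mul_assoc, inv'_mul hk, one_mul, mul_assoc, inv'_mul hk, mul_one]
  rw [e, par_mul, par_mul, h, P4_mul_one, ← par_mul, inv'_mul hk, par_one]

/-- `tr g = (tup g).1 + (tup g).2.2.2`. [folklore] -/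
theorem trace_eq_tup (g : M4) : g.trace = (tup g).1 + (tup g).2.2.2 := by
  rw [Matrix.trace_fin_two]; rfl

/-- `-1` is not a square in `ℚ`. [folklore] -/
private theorem not_isSquare_neg_one_rat : ¬ IsSquare (-1 : ℚ) := by
  rintro ⟨r, hr⟩
  nlinarith [mul_self_nonneg r]

variable (W : WeierstrassCurve ℚ) [W.IsElliptic] [W.IsGloballyMinimal]

/-- **Non-surjective at a good supersingular `2` ⟹ `Im ρ̄_{E,4}` is conjugate into `ℍ`** (tree: the non-surjective
branch is the D–D family `exists_j_eq_of_not_twoAdicSurjective_of_goodSS_two`, and D–D's Lemma (3) ⟹ (1)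
`LevelFour.conj_subset_HH_iff_exists_j_eq`, whose hypotheses `ρ̄₂` onto / `−Δ ∉ ℚ^{×2}` hold at a good supersingular `2`).
[cite: DokchitserDokchitserMathZ2012, Theorem (2) and Lemma (p. 962)] -/
theorem exists_conj_subset_HH_of_not_twoAdicSurjective (h : GoodSS W 2) (hns : ¬ TwoAdicSurjective W) :
    ∃ k : M4, k.det * k.det = 1 ∧
      ∀ σ : Field.absoluteGaloisGroup ℚ, tup (k * LevelFour.M W two_ne_zero σ * inv' k) ∈ HH := by
  haveI : PerfectField ℚ := PerfectField.ofCharZero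
  exact (LevelFour.conj_subset_HH_iff_exists_j_eq W two_ne_zero (by norm_num) not_isSquare_neg_one_rat
    (SSTwoAdicImage.hasSurjectiveModNGaloisRep_two_of_goodSS_two W h)
    (SSTwoAdicImage.not_isSquare_neg_Δ_of_goodSS_two W h)).mpr
    (SSTwoAdicImage.exists_j_eq_of_not_twoAdicSurjective_of_goodSS_two W h hns)

/-- ★ **THE `τ`-OBSTRUCTION AT LEVEL `4`.** For `E/ℚ` good supersingular at `2` with `ρ_{E,2^∞}` NOT onto:
every `σ ∈ Γ_ℚ` with `det ρ̄_{E,4}(σ) = 1` and `tr ρ̄_{E,4}(σ) = 2` has `ρ̄_{E,4}(σ) ≡ 1 (mod 2)`.  In particular no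
`σ ∈ Gal(ℚ̄/ℚ(ζ_{2^∞}))` has `T₂E/(σ − 1)T₂E` free of rank one: Rubin's Hyp(ℚ_∞, T₂E)(i) = the `τ` of Kato's Thm 13.4(3)
fails on the whole non-surjective locus of the crux. [cite: KatoAsterisque2004, Thm 13.4 (3)]
[cite: DokchitserDokchitserMathZ2012, Theorem (2)] -/
theorem par_rhoMod4_eq_one_of_det_eq_one_of_trace_eq_two (h : GoodSS W 2) (hns : ¬ TwoAdicSurjective W)
    (σ : Field.absoluteGaloisGroup ℚ) (hdet : (LevelFour.M W two_ne_zero σ).det = 1)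
    (htr : (LevelFour.M W two_ne_zero σ).trace = 2) :
    par (LevelFour.M W two_ne_zero σ) = (1, 0, 0, 1) := by
  obtain ⟨k, hk, hH⟩ := exists_conj_subset_HH_of_not_twoAdicSurjective W h hns
  have hmem := hH σ
  have hdet' : Q4.det (tup (k * LevelFour.M W two_ne_zero σ * inv' k)) = 1 := by
    rw [← det_eq, det_conj _ _ hk, hdet]
  have htr' : (tup (k * LevelFour.M W two_ne_zero σ * inv' k)).1 +
      (tup (k * LevelFour.M W two_ne_zero σ * inv' k)).2.2.2 = 2 := by
    rw [← trace_eq_tup, trace_conj _ _ hk, htr]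
  exact par_eq_one_of_par_conj_eq_one k _ hk
    (HH_par_eq_one_of_det_eq_one_of_trace_eq_two _ hmem hdet' htr')

/-! ## §2 The level-4 Smith computation in `M₂(ℤ/4ℤ)` -/

section Smith


/-- The trichotomy for an element of `ℤ/4`: `0`, `2`, or a unit (squares to `1`). [folklore] -/
private theorem zmod4_cases : ∀ d : ZMod 4, d = 0 ∨ d = 2 ∨ d * d = 1 := by decide

/-- `red x = 0 ⟹ 2x = 0` in `ℤ/4`. [folklore] -/
private theorem two_mul_eq_zero_of_red_eq_zero : ∀ x : ZMod 4, red x = 0 → 2 * x = 0 := by decide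

/-- `red x = 1 ⟹ 2(x − 1) = 0` in `ℤ/4`. [folklore] -/
private theorem two_mul_sub_one_eq_zero_of_red_eq_one : ∀ x : ZMod 4, red x = 1 → 2 * (x - 1) = 0 := by decide

/-- The parity core: `e₀ ≡ m₀ v`, `e₁ ≡ m₁ v (mod 2)` is impossible in `(ℤ/4)²`. [folklore] -/
private theorem parity_core : ∀ a b c d : ZMod 4,
    2 * (1 - a * c) = 0 → 2 * (0 - a * d) = 0 → 2 * (0 - b * c) = 0 → 2 * (1 - b * d) = 0 → False := by
  decide

/-- `det (A − 1) = (a₀₀ − 1)(a₁₁ − 1) − a₀₁ a₁₀`. [folklore] -/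
private theorem det_sub_one (A : M4) : (A - 1).det = (A 0 0 - 1) * (A 1 1 - 1) - A 0 1 * A 1 0 := by
  rw [Matrix.det_fin_two]
  simp [Matrix.sub_apply]

/-- Coordinates of `(A − 1)·u`. [folklore] -/
private theorem sub_one_mulVec_apply_zero (A : M4) (u : Fin 2 → ZMod 4) :
    ((A - 1) *ᵥ u) 0 = (A 0 0 - 1) * u 0 + A 0 1 * u 1 := by
  simp [Matrix.mulVec, dotProduct, Fin.sum_univ_two, Matrix.sub_apply, Matrix.one_apply]

/-- Coordinates of `(A − 1)·u`. [folklore] -/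
private theorem sub_one_mulVec_apply_one (A : M4) (u : Fin 2 → ZMod 4) :
    ((A - 1) *ᵥ u) 1 = A 1 0 * u 0 + (A 1 1 - 1) * u 1 := by
  simp [Matrix.mulVec, dotProduct, Fin.sum_univ_two, Matrix.sub_apply, Matrix.one_apply]

/-- **Level-4 Smith computation.**  Let `A ∈ M₂(ℤ/4)` with `det A = 1`, and `v ∈ (ℤ/4)²` such that the cokernel of
`A − 1` is generated by the class of `v` (`e₀ − m₀v, e₁ − m₁v ∈ im(A − 1)`) with `v ∉ im(A − 1)` and `2v ∉ im(A − 1)`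
(the class of `v` has order `4`).  Then `tr A = 2` and `A ≢ 1 (mod 2)`.  (Smith normal form of `A − 1` is `diag(1, 0)`.)
[folklore] -/
theorem trace_eq_two_and_par_ne_one_of_cyclic (A : M4) (v u₀ u₁ : Fin 2 → ZMod 4) (m₀ m₁ : ZMod 4)
    (h₀ : (A - 1) *ᵥ u₀ = Pi.single 0 1 - m₀ • v) (h₁ : (A - 1) *ᵥ u₁ = Pi.single 1 1 - m₁ • v)
    (hv1 : ∀ u, (A - 1) *ᵥ u ≠ v) (hv2 : ∀ u, (A - 1) *ᵥ u ≠ 2 • v) (hdet : A.det = 1) :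
    A.trace = 2 ∧ par A ≠ (1, 0, 0, 1) := by
  constructor
  · rcases zmod4_cases (A - 1).det with h0 | h2 | hu
    · rw [det_sub_one] at h0
      rw [Matrix.det_fin_two] at hdet
      rw [Matrix.trace_fin_two]
      linear_combination hdet - h0
    · exfalso
      refine hv2 ((A - 1).adjugate *ᵥ v) ?_
      rw [Matrix.mulVec_mulVec, Matrix.mul_adjugate, h2, Matrix.smul_mulVec, Matrix.one_mulVec,
        ← Nat.cast_smul_eq_nsmul (ZMod 4) 2 v, Nat.cast_ofNat]
    · exfalso
      refine hv1 ((A - 1).det • ((A - 1).adjugate *ᵥ v)) ?_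
      rw [Matrix.mulVec_smul, Matrix.mulVec_mulVec, Matrix.mul_adjugate, Matrix.smul_mulVec, Matrix.one_mulVec,
        smul_smul, hu, one_smul]
  · intro hpar
    have hp : red (A 0 0) = 1 ∧ red (A 0 1) = 0 ∧ red (A 1 0) = 0 ∧ red (A 1 1) = 1 := by
      simpa [par, Q4.par, tup, Prod.mk.injEq] using hpar
    -- `2 · (A − 1) u = 0` coordinatewise
    have hk0 : ∀ u : Fin 2 → ZMod 4, 2 * ((A - 1) *ᵥ u) 0 = 0 := fun u ↦ by
      rw [sub_one_mulVec_apply_zero]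
      linear_combination (u 0) * two_mul_sub_one_eq_zero_of_red_eq_one _ hp.1 +
        (u 1) * two_mul_eq_zero_of_red_eq_zero _ hp.2.1
    have hk1 : ∀ u : Fin 2 → ZMod 4, 2 * ((A - 1) *ᵥ u) 1 = 0 := fun u ↦ by
      rw [sub_one_mulVec_apply_one]
      linear_combination (u 0) * two_mul_eq_zero_of_red_eq_zero _ hp.2.2.1 +
        (u 1) * two_mul_sub_one_eq_zero_of_red_eq_one _ hp.2.2.2
    have e00 : (Pi.single 0 1 - m₀ • v : Fin 2 → ZMod 4) 0 = 1 - m₀ * v 0 := by simp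
    have e01 : (Pi.single 0 1 - m₀ • v : Fin 2 → ZMod 4) 1 = 0 - m₀ * v 1 := by simp
    have e10 : (Pi.single 1 1 - m₁ • v : Fin 2 → ZMod 4) 0 = 0 - m₁ * v 0 := by simp
    have e11 : (Pi.single 1 1 - m₁ • v : Fin 2 → ZMod 4) 1 = 1 - m₁ * v 1 := by simp
    have q00 := hk0 u₀; rw [h₀, e00] at q00
    have q01 := hk1 u₀; rw [h₀, e01] at q01
    have q10 := hk0 u₁; rw [h₁, e10] at q10
    have q11 := hk1 u₁; rw [h₁, e11] at q11
    exact parity_core m₀ m₁ (v 0) (v 1) q00 q01 q10 q11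

end Smith

/-! ## §3 (im) at `2` fails on the non-surjective good-supersingular locus -/

/-- ★★ **The Euler-system big-image hypothesis at `p = 2` is unsatisfiable on the non-surjective good-supersingular
locus.**  For `E/ℚ` (globally minimal) with good supersingular reduction at `2` and `ρ_{E,2^∞}` not surjective
(equivalently `j(E) = −4t³(t+8)`, `SSTwoAdicImage.twoAdicSurjective_iff_forall_j_ne_of_goodSS_two`), there is NO
`σ ∈ Gal(ℚ̄/ℚ(μ_{2^∞}))` with `T₂E/(σ − 1)T₂E ≅ ℤ₂`: `¬ Rank1Residual.BigIm W 2` — Kato's Thm. 13.4 (3) / 17.4 (3),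
Rubin's Thm. 2.3.3–2.3.7 under Hyp(ℚ_∞,T₂E), KLZ's Thm. 11.6.4 under Hyp(BI), BCS's Thm. 1.1.2 (b) under (im) have an
EMPTY hypothesis there, although `ρ̄_{E,2}` IS surjective. [cite: Kato2004, Thm. 13.4 (3)]
[cite: DokchitserDokchitserMathZ2012, Theorem (2)] [cite: BurungaleCastellaSkinner2025, p. 2 (im)] -/
theorem not_bigIm_two_of_goodSS_of_not_twoAdicSurjective (hss : GoodSS W 2) (hns : ¬ TwoAdicSurjective W) :
    ¬ BigIm W 2 := by
  rintro ⟨σ, hσ, ⟨Ψ⟩⟩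
  have h2Q : (2 : ℚ) ≠ 0 := two_ne_zero
  obtain ⟨A, hA⟩ : ∃ A : M4, A = LevelFour.M W h2Q σ := ⟨_, rfl⟩
  ------------------------------------------------------------------
  -- (1) `det ρ̄₄(σ) = 1`: `σ` fixes the primitive fourth root of unity `ζ = e₄(P₀, Q₀)`
  ------------------------------------------------------------------
  have hdet : A.det = 1 := by
    have hfix : σ • LevelFour.zeta W h2Q = LevelFour.zeta W h2Q := by
      rw [absoluteGaloisGroup.smul_def]
      exact hσ _ 2 (by rw [show (2 : ℕ) ^ 2 = 4 from rfl]; exact LevelFour.zeta_pow_four W h2Q)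
    rw [LevelFour.smul_zeta W h2Q σ, ← hA] at hfix
    have hsq := LevelFour.zeta_sq W h2Q
    have hd : A.det = 1 ∨ A.det = 3 := by
      have h : A.det * A.det = 1 := by
        rw [hA]; exact (det_sq (rhoMat W (LevelFour.frame4 W h2Q)) σ).1
      revert h; generalize A.det = d; revert d; decide
    rcases hd with h | h
    · exact h
    · exfalso
      rw [h, show (3 : ZMod 4).val = 3 from rfl, pow_succ, hsq] at hfix
      -- `hfix : -1 * ζ = ζ`
      have hz0 : LevelFour.zeta W h2Q = 0 := by
        have h2z : (2 : AlgebraicClosure ℚ) * LevelFour.zeta W h2Q = 0 := by linear_combination -hfix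
        exact (mul_eq_zero.mp h2z).resolve_left two_ne_zero
      rw [hz0] at hsq
      norm_num at hsq
  ------------------------------------------------------------------
  -- (2) reduction modulo `4`: `E[4] ⧸ (σ − 1)E[4]` is cyclic, with a generator of order `4`
  --     (verbatim `TateModuleTransvectionCriterionProofs`, `p ↦ 4`)
  ------------------------------------------------------------------
  set S : Submodule ℤ_[2] (W.tateModule 2) := LinearMap.range (W.galoisRepTate 2 σ - LinearMap.id) with hS_def
  set f : geomTorsion W 4 →+ geomTorsion W 4 :=
    (Multiplicative.toAdd (galoisRepTorsion W 4 σ)).toAddMonoidHom - AddMonoidHom.id (geomTorsion W 4) with hf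
  set R : AddSubgroup (geomTorsion W 4) := f.range with hR
  have h44 : ((2 ^ 2 : ℕ) : ℤ) = 4 := by norm_num
  have hmem : ∀ a : W.tateModule 2, TateModule.proj 2 2 a ∈ geomTorsion W 4 := fun a ↦ by
    have h := proj_tateModule_mem_geomTorsion W 2 2 a
    rwa [h44] at h
  set π : W.tateModule 2 →+ geomTorsion W 4 := (TateModule.proj 2 2).codRestrict (geomTorsion W 4) hmem with hπ
  have hπval : ∀ a, (π a : geomPoints W) = TateModule.proj 2 2 a := fun a ↦ rfl
  have hπsurj : Function.Surjective π := by
    intro P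
    have hP : (P : geomPoints W) ∈ geomTorsion W ((2 ^ 2 : ℕ) : ℤ) := by rw [h44]; exact P.2
    obtain ⟨a, ha⟩ := proj_surjective_of_isAlgClosed_holds W 2 2 hP
    exact ⟨a, Subtype.ext ha⟩
  have hπker : ∀ a, π a = 0 → ∃ b : W.tateModule 2, a = ((4 : ℕ) : ℤ_[2]) • b := by
    intro a ha
    have h0 : TateModule.proj 2 2 a = 0 := by rw [← hπval a, ha, ZeroMemClass.coe_zero]
    have h1 : TateModule.proj 2 1 a = 0 := by
      rw [← TateModule.smul_proj_succ 1 a]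
      change 2 • TateModule.proj 2 2 a = 0
      rw [h0, smul_zero]
    have hb1 : TateModule.proj 2 1 (TateModule.div a h1) = 0 := by rw [TateModule.proj_div]; exact h0
    refine ⟨TateModule.div (TateModule.div a h1) hb1, ?_⟩
    rw [show ((4 : ℕ) : ℤ_[2]) = ((2 : ℕ) : ℤ_[2]) * ((2 : ℕ) : ℤ_[2]) by norm_num, mul_smul,
      TateModule.p_smul_div, TateModule.p_smul_div]
  have hπsmul : ∀ a, π (σ • a) = σ • π a := fun a ↦ Subtype.ext rfl
  have h4E : ∀ e : geomTorsion W 4, 4 • e = 0 := by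
    intro e
    apply Subtype.ext
    have he : 4 • (e : geomPoints W) = 0 := (AddSubgroup.torsionBy.nsmul_iff (A := geomPoints W) (n := 4)).mp e.2
    rw [AddSubmonoidClass.coe_nsmul, ZeroMemClass.coe_zero, he]
  set ψ : W.tateModule 2 →+ geomTorsion W 4 ⧸ R := (QuotientAddGroup.mk' R).comp π with hψ
  have hψ_apply : ∀ a, ψ a = QuotientAddGroup.mk (π a) := fun a ↦ rfl
  -- Claim A: `ψ` kills `S = (σ − 1)T`
  have hfπ : ∀ b : W.tateModule 2, f (π b) = π (σ • b - b) := by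
    intro b
    rw [map_sub, hπsmul, hf, AddMonoidHom.sub_apply, AddMonoidHom.id_apply, AddEquiv.coe_toAddMonoidHom]
    rfl
  have hsub_mem : ∀ b : W.tateModule 2, σ • b - b ∈ S := by
    intro b
    refine ⟨b, ?_⟩
    rw [LinearMap.sub_apply, galoisRepTate_apply_apply, LinearMap.id_apply]
  have hAk : ∀ a ∈ S, ψ a = 0 := by
    rintro a ⟨b, rfl⟩
    rw [hψ_apply, QuotientAddGroup.eq_zero_iff, LinearMap.sub_apply, galoisRepTate_apply_apply,
      LinearMap.id_apply, ← hfπ]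
    exact ⟨π b, rfl⟩
  -- Claim B: `ψ` kills `4T`
  have hB : ∀ a : W.tateModule 2, ψ (((4 : ℕ) : ℤ_[2]) • a) = 0 := by
    intro a
    rw [Nat.cast_smul_eq_nsmul, hψ_apply, map_nsmul, h4E, QuotientAddGroup.mk_zero]
  -- Claim C: exactness — `ψ a = 0` forces `a ∈ S + 4T`
  have hC : ∀ a : W.tateModule 2, ψ a = 0 →
      ∃ s ∈ S, ∃ b : W.tateModule 2, a = s + ((4 : ℕ) : ℤ_[2]) • b := by
    intro a ha
    rw [hψ_apply, QuotientAddGroup.eq_zero_iff] at ha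
    obtain ⟨e, he⟩ := ha
    obtain ⟨b, rfl⟩ := hπsurj e
    rw [hfπ] at he
    have hker : π (a - (σ • b - b)) = 0 := by rw [map_sub, he, sub_self]
    obtain ⟨c, hc⟩ := hπker _ hker
    exact ⟨σ • b - b, hsub_mem b, c, by rw [← hc]; abel⟩
  -- a generator `t₀` of `T/S ≅ ℤ₂`
  obtain ⟨t₀, ht₀⟩ := Submodule.Quotient.mk_surjective S (Ψ.symm 1)
  have hQ1 : ∀ a : W.tateModule 2, ∃ c : ℤ_[2], a - c • t₀ ∈ S := by
    intro a
    refine ⟨Ψ (Submodule.Quotient.mk a), (Submodule.Quotient.eq S).mp ?_⟩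
    rw [Submodule.Quotient.mk_smul, ht₀]
    apply Ψ.injective
    rw [map_smul, LinearEquiv.apply_symm_apply, smul_eq_mul, mul_one]
  have hQ2 : ∀ m : ℕ, (∃ s ∈ S, ∃ b : W.tateModule 2,
      ((m : ℤ_[2]) • t₀ : W.tateModule 2) = s + ((4 : ℕ) : ℤ_[2]) • b) → 4 ∣ m := by
    rintro m ⟨s, hs, b, hb⟩
    have h1 : (m : ℤ_[2]) • Submodule.Quotient.mk (p := S) t₀ =
        ((4 : ℕ) : ℤ_[2]) • Submodule.Quotient.mk (p := S) b := by
      rw [← Submodule.Quotient.mk_smul, hb, Submodule.Quotient.mk_add,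
        (Submodule.Quotient.mk_eq_zero S).mpr hs, zero_add, Submodule.Quotient.mk_smul]
    have h2 := congrArg Ψ h1
    rw [map_smul, map_smul, ht₀, LinearEquiv.apply_symm_apply, smul_eq_mul, mul_one,
      smul_eq_mul] at h2
    have h3 := congrArg (PadicInt.toZModPow (p := 2) 2) h2
    rw [map_natCast, map_mul, map_natCast] at h3
    have h40 : ((4 : ℕ) : ZMod (2 ^ 2)) = 0 := by decide
    rw [h40, zero_mul] at h3
    exact (ZMod.natCast_eq_zero_iff m (2 ^ 2)).mp h3
  -- every `c ∈ ℤ₂` is `m + 4 c'` with `m ∈ ℕ`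
  have hdecomp : ∀ c : ℤ_[2], ∃ (m : ℕ) (c' : ℤ_[2]), c = m + ((4 : ℕ) : ℤ_[2]) * c' := by
    intro c
    refine ⟨(PadicInt.toZModPow 2 c).val, ?_⟩
    have hk : c - ((PadicInt.toZModPow 2 c).val : ℤ_[2]) ∈ RingHom.ker (PadicInt.toZModPow (p := 2) 2) := by
      rw [RingHom.mem_ker, map_sub, map_natCast, ZMod.natCast_zmod_val, sub_self]
    rw [PadicInt.ker_toZModPow, Ideal.mem_span_singleton] at hk
    obtain ⟨c', hc'⟩ := hk
    refine ⟨c', ?_⟩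
    rw [show ((4 : ℕ) : ℤ_[2]) = ((2 : ℕ) : ℤ_[2]) ^ 2 by norm_num, ← hc']
    abel
  -- the generator `x₀ = ψ t₀` of `E[4]/R`
  set x₀ : geomTorsion W 4 ⧸ R := ψ t₀ with hx₀
  have hψsmul : ∀ c : ℤ_[2], ∃ m : ℕ, ψ (c • t₀) = m • x₀ := by
    intro c
    obtain ⟨m, c', rfl⟩ := hdecomp c
    refine ⟨m, ?_⟩
    rw [add_smul, map_add, mul_smul, hB, add_zero, Nat.cast_smul_eq_nsmul, map_nsmul]
  have hgen : ∀ y : geomTorsion W 4 ⧸ R, ∃ m : ℕ, y = m • x₀ := by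
    intro y
    obtain ⟨e, rfl⟩ := QuotientAddGroup.mk_surjective y
    obtain ⟨a, rfl⟩ := hπsurj e
    obtain ⟨c, hc⟩ := hQ1 a
    obtain ⟨m, hm⟩ := hψsmul c
    refine ⟨m, ?_⟩
    rw [← hm, ← hψ_apply, ← sub_eq_zero, ← map_sub]
    exact hAk _ hc
  have horder : ∀ m : ℕ, m • x₀ = 0 → 4 ∣ m := by
    intro m hm
    apply hQ2 m
    apply hC
    rw [Nat.cast_smul_eq_nsmul, map_nsmul]
    exact hm
  have hx₀ne : x₀ ≠ 0 := by
    intro h0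
    have h := horder 1 (by rw [one_smul]; exact h0)
    exact absurd (Nat.le_of_dvd one_pos h) (by norm_num)
  have h2x₀ : (2 : ℕ) • x₀ ≠ 0 := by
    intro h0
    have h := horder 2 h0
    exact absurd (Nat.le_of_dvd two_pos h) (by norm_num)
  ------------------------------------------------------------------
  -- (3) coordinates in the frame `e : E[4] ≃+ (ℤ/4)²`
  ------------------------------------------------------------------
  set e : geomTorsion W 4 ≃+ (Fin 2 → ZMod 4) := LevelFour.frame4 W h2Q with he_def
  have hmv : ∀ P : geomTorsion W 4, e (σ • P) = A *ᵥ e P := fun P ↦ by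
    rw [hA]; exact rhoMat_mulVec W e σ P
  have hcoord : ∀ P : geomTorsion W 4, e (f P) = (A - 1) *ᵥ e P := by
    intro P
    rw [hf, AddMonoidHom.sub_apply, AddMonoidHom.id_apply, AddEquiv.coe_toAddMonoidHom, galoisRepTorsion_apply,
      map_sub, hmv, Matrix.sub_mulVec, Matrix.one_mulVec]
  -- the lift `t = π t₀` of `x₀` and its coordinate vector `v`
  set t : geomTorsion W 4 := π t₀ with ht_def
  have hx₀t : x₀ = QuotientAddGroup.mk t := by rw [hx₀, hψ_apply]
  -- generation: `e P − m v ∈ im(A − 1)`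
  have hgen' : ∀ P : geomTorsion W 4, ∃ (m : ℕ) (u : Fin 2 → ZMod 4), (A - 1) *ᵥ u = e P - (m : ZMod 4) • e t := by
    intro P
    obtain ⟨m, hm⟩ := hgen (QuotientAddGroup.mk P)
    rw [hx₀t, ← QuotientAddGroup.mk_nsmul, QuotientAddGroup.eq_iff_sub_mem] at hm
    obtain ⟨Q, hQ⟩ := AddMonoidHom.mem_range.mp hm
    refine ⟨m, e Q, ?_⟩
    rw [← hcoord, hQ, map_sub, map_nsmul, Nat.cast_smul_eq_nsmul]
  -- `v ∉ im(A − 1)` and `2v ∉ im(A − 1)`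
  have hv1 : ∀ u, (A - 1) *ᵥ u ≠ e t := by
    intro u hu
    have hft : f (e.symm u) = t := e.injective (by rw [hcoord, e.apply_symm_apply, hu])
    have hmemR : t ∈ R := ⟨e.symm u, hft⟩
    exact hx₀ne (by rw [hx₀t]; exact (QuotientAddGroup.eq_zero_iff t).mpr hmemR)
  have hv2 : ∀ u, (A - 1) *ᵥ u ≠ 2 • e t := by
    intro u hu
    have hft : f (e.symm u) = 2 • t := e.injective (by rw [hcoord, e.apply_symm_apply, hu, map_nsmul])
    have hmemR : 2 • t ∈ R := ⟨e.symm u, hft⟩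
    exact h2x₀ (by rw [hx₀t, ← QuotientAddGroup.mk_nsmul]; exact (QuotientAddGroup.eq_zero_iff _).mpr hmemR)
  obtain ⟨m₀, u₀, h₀⟩ := hgen' (e.symm (Pi.single 0 1))
  obtain ⟨m₁, u₁, h₁⟩ := hgen' (e.symm (Pi.single 1 1))
  rw [e.apply_symm_apply] at h₀ h₁
  ------------------------------------------------------------------
  -- (4)+(5) Smith computation vs the `τ`-obstruction in `ℍ`
  ------------------------------------------------------------------
  obtain ⟨htr, hpar⟩ :=
    trace_eq_two_and_par_ne_one_of_cyclic A (e t) u₀ u₁ (m₀ : ZMod 4) (m₁ : ZMod 4) h₀ h₁ hv1 hv2 hdet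
  rw [hA] at hdet htr hpar
  exact hpar (par_rhoMod4_eq_one_of_det_eq_one_of_trace_eq_two W hss hns σ hdet htr)

/-- ★ **K81-A HOLDS**: on good supersingular reduction at `2`, hypothesis (im) at `p = 2` FORCES 2-adic surjectivity
(contrapositive of the main theorem; this is `K81GaloisLevel.BigImTwoForcesTwoAdicSurjectiveOnGoodSS` @6c20ff578417,
restated verbatim to stay import-free of Cruxes modules). [cite: Kato2004, Thm. 13.4 (3)]
[cite: DokchitserDokchitserMathZ2012, Theorem (2)] -/
theorem bigImTwoForcesTwoAdicSurjectiveOnGoodSS_holds :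
    ∀ (W : WeierstrassCurve ℚ) [W.IsElliptic] [W.IsGloballyMinimal], GoodSS W 2 → BigIm W 2 → TwoAdicSurjective W := by
  intro W _ _ hss him
  by_contra hns
  exact not_bigIm_two_of_goodSS_of_not_twoAdicSurjective W hss hns him

/-- Bookkeeping corollary in the shape of the barrier file `EulerSystemBigImageAtSmallImage`
(`not_exists_galoisRepTate_quotient_equiv`, `σ • t` spelling, `− 1` spelling). [cite: BurungaleCastellaSkinner2025, p. 2 (im)] -/
theorem not_exists_galoisRepTate_two_quotient_equiv (hss : GoodSS W 2) (hns : ¬ TwoAdicSurjective W) :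
    ¬ ∃ σ : absoluteGaloisGroup ℚ,
      (∀ (n : ℕ) (t : AlgebraicClosure ℚ), t ^ 2 ^ n = 1 → σ • t = t) ∧
        Nonempty (((W.tateModule 2) ⧸ LinearMap.range (W.galoisRepTate 2 σ - 1)) ≃ₗ[ℤ_[2]] ℤ_[2]) := by
  rintro ⟨σ, hσ, hΨ⟩
  refine not_bigIm_two_of_goodSS_of_not_twoAdicSurjective W hss hns ⟨σ, fun ζ n hζ ↦ ?_, ?_⟩
  · rw [← absoluteGaloisGroup.smul_def]; exact hσ n ζ hζ
  · simpa only [Module.End.one_eq_id] using hΨ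

/-! ## §4 The converse K81-B and the equivalence K81-AB (v2)

K81-B is the tree theorem `WeierstrassCurve.exists_quotient_range_galoisRepTate_sub_one_equiv_of_forall_surjective`
(`TateModuleBigImageOfSurjectiveProofs`, any prime `p`: levelwise surjectivity ⟹ (im); `σ` acts by `(1 1; 0 1)` in a
`ℤ_p`-basis, `det ρ_T = χ_p` by the Weil pairing, `Γ_ℚ` compact) at `p = 2`, bridged to the cells' spellings: `TwoAdicSurjective W`
quantifies `n > 0` with `(2 : ℤ) ^ n` (level `1` is supplied here: `E[1] = 0`), and `BigIm` writes the root-of-unity clause with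
`toAlgEquiv` and the endomorphism with `− LinearMap.id`. -/

/-- Level one: `E[1] = 0`, so `ρ̄_{E,1} : Γ_ℚ → Aut(E[1])` is onto (every automorphism of the zero group is `ρ̄(1)`). [folklore] -/
theorem hasSurjectiveModNGaloisRep_one (V : WeierstrassCurve ℚ) [V.IsElliptic] : V.HasSurjectiveModNGaloisRep 1 := by
  have hzero : ∀ P : geomTorsion V 1, (P : geomPoints V) = 0 := by
    intro P
    have hP : (P : geomPoints V) ∈ (Submodule.torsionBy ℤ (geomPoints V) 1).toAddSubgroup := P.2
    rw [Submodule.mem_toAddSubgroup, Submodule.mem_torsionBy_iff, one_smul] at hP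
    exact hP
  haveI : Subsingleton (geomTorsion V 1) := ⟨fun P Q ↦ Subtype.ext ((hzero P).trans (hzero Q).symm)⟩
  intro β
  exact ⟨1, Multiplicative.toAdd.injective (AddEquiv.ext fun P ↦ Subsingleton.elim _ _)⟩

/-- ★ **K81-B HOLDS** (any `E/ℚ`, no reduction hypothesis): 2-adic surjectivity gives (im) at `2` — an element acting on `T₂E`
by `(1 1; 0 1)` fixes `μ_{2^∞}` (`det = χ`) and has `T₂E/(σ − 1)T₂E ≅ ℤ₂`.  This is `K81GaloisLevel.TwoAdicSurjectiveGivesBigImTwo`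
@6c20ff578417, restated verbatim; the mathematics is the tree theorem
`exists_quotient_range_galoisRepTate_sub_one_equiv_of_forall_surjective` (`p = 2`).
[cite: BurungaleCastellaSkinner2025, p. 2 (im) and Rem. 1.1.3 (i)] [cite: Skinner2016PacificMC, §2.5 (a), (b)] -/
theorem twoAdicSurjectiveGivesBigImTwo_holds :
    ∀ (W : WeierstrassCurve ℚ) [W.IsElliptic], TwoAdicSurjective W → BigIm W 2 := by
  intro V _ hts
  have hsurj : ∀ n : ℕ, V.HasSurjectiveModNGaloisRep (2 ^ n : ℕ) := by
    intro n
    rcases Nat.eq_zero_or_pos n with rfl | hn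
    · simpa using hasSurjectiveModNGaloisRep_one V
    · simpa [Nat.cast_pow] using hts n hn
  obtain ⟨σ, hσ, hΨ⟩ := exists_quotient_range_galoisRepTate_sub_one_equiv_of_forall_surjective V 2 hsurj
  refine ⟨σ, fun ζ n hζ ↦ ?_, ?_⟩
  · rw [← absoluteGaloisGroup.smul_def]; exact hσ n ζ hζ
  · simpa only [Module.End.one_eq_id] using hΨ

/-- ★ **K81-AB HOLDS**: on good supersingular reduction at `2`, (im) at `2` ⟺ 2-adic surjectivity
(`K81GaloisLevel.BigImTwoIffTwoAdicSurjectiveOnGoodSS` @6c20ff578417, restated verbatim). [cite: Kato2004, Thm. 13.4 (3)]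
[cite: DokchitserDokchitserMathZ2012, Theorem (2)] -/
theorem bigImTwoIffTwoAdicSurjectiveOnGoodSS_holds :
    ∀ (W : WeierstrassCurve ℚ) [W.IsElliptic] [W.IsGloballyMinimal], GoodSS W 2 → (BigIm W 2 ↔ TwoAdicSurjective W) :=
  fun V _ _ hss ↦ ⟨bigImTwoForcesTwoAdicSurjectiveOnGoodSS_holds V hss, twoAdicSurjectiveGivesBigImTwo_holds V⟩

/-- ★ **(im) at `2` is decided by `j` on the good-supersingular locus**: for `E/ℚ` (globally minimal) with good supersingular
reduction at `2`, Kato's / Rubin's / KLZ's / BCS's big-image hypothesis at `p = 2` holds iff `j(E) ≠ −4t³(t+8)` for every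
`t ∈ ℚ` (Dokchitser–Dokchitser's criterion, tree theorem `SSTwoAdicImage.twoAdicSurjective_iff_forall_j_ne_of_goodSS_two`).
[cite: DokchitserDokchitserMathZ2012, Theorem (2)] [cite: Kato2004, Thm. 13.4 (3)] -/
theorem bigIm_two_iff_forall_j_ne_of_goodSS_two (hss : GoodSS W 2) :
    BigIm W 2 ↔ ∀ t : ℚ, W.j ≠ -4 * t ^ 3 * (t + 8) :=
  (bigImTwoIffTwoAdicSurjectiveOnGoodSS_holds W hss).trans
    (SSTwoAdicImage.twoAdicSurjective_iff_forall_j_ne_of_goodSS_two W hss)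

/-! ## §5 (v3, -imc g30 2026-08-31) K81-D — «not even with defect 2»: no `g ∈ Γ_ℚ` fixing `ζ₄` has `#(E[4]/(g−1)E[4]) = 8`

Next question after K81 for a defect-tolerant Euler-system argument at `2` on the D–D locus `X_ℍ`: is there `g ∈ G_{ℚ(μ_{2^∞})}`
with `T₂E/(g−1)T₂E ≅ ℤ₂ ⊕ ℤ/2`?  Reducing mod `4` such a `g` would give `#(E[4]/(g−1)E[4]) = 8`.  We prove this never happens
for `g` fixing `ζ₄`: then `det ρ̄₄(g) = 1` and `Im ρ̄₄ ⊂ k⁻¹ℍk`, and for each of the twelve `det = 1` elements `h ∈ ℍ` the image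
of `h − 1` on `(ℤ/4)²` does not have exactly two elements (`ℍ ∩ ker(→ GL₂(ℤ/2)) = 1 + 2·𝔽₄`; kernel `decide`).  So the minimal
defect of a Chebotarev element on `X_ℍ` is `4` (`g ↦ (1 4; 0 1)` on the generic member). -/

section Defect

/-- The image vector `(q − 1)u` in tuple coordinates (`q = (a,b,c,d) ↔ (a b; c d)`, `u = (x, y)`). -/
def Nvec (q : Q4) (u : ZMod 4 × ZMod 4) : ZMod 4 × ZMod 4 :=
  ((q.1 - 1) * u.1 + q.2.1 * u.2, q.2.2.1 * u.1 + (q.2.2.2 - 1) * u.2)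

set_option maxRecDepth 100000 in
set_option maxHeartbeats 0 in
/-- **Kernel fact about `ℍ`:** for `h ∈ ℍ` with `det h = 1`, the image of `h − 1` on `(ℤ/4)²` never has exactly two elements
(a nonzero value exists ⟹ two distinct nonzero values exist).  Table (MEMO-imc §10.114-add4): the image orders on
`ℍ ∩ SL₂(ℤ/4)` are `16, 8, 8, …` for `tr ≠ 2` and `1` (`h = 1`), `4` (`h = −1`); never `2`.
[cite: DokchitserDokchitserMathZ2012, proof of Theorem (2) (the subgroup ℍ)] -/
theorem HH_image_sub_one_ne_two : ∀ h ∈ HH, Q4.det h = 1 → (∃ u : ZMod 4 × ZMod 4, Nvec h u ≠ 0) →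
    ¬ ∀ u u' : ZMod 4 × ZMod 4, Nvec h u = 0 ∨ Nvec h u' = 0 ∨ Nvec h u = Nvec h u' := by
  decide +kernel

/-- `(B *ᵥ u)` in tuple coordinates. -/
private theorem mulVec_sub_one_eq_Nvec (B : M4) (u : Fin 2 → ZMod 4) :
    ((B - 1) *ᵥ u) 0 = (Nvec (tup B) (u 0, u 1)).1 ∧ ((B - 1) *ᵥ u) 1 = (Nvec (tup B) (u 0, u 1)).2 := by
  simp [Nvec, tup, Matrix.mulVec, dotProduct, Fin.sum_univ_two, Matrix.sub_apply, Matrix.one_apply]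

private theorem vec_eq_iff (v w : Fin 2 → ZMod 4) : v = w ↔ (v 0, v 1) = (w 0, w 1) := by
  constructor
  · rintro rfl; rfl
  · intro h
    simp only [Prod.mk.injEq] at h
    funext i; fin_cases i
    · exact h.1
    · exact h.2

private theorem mulVec_sub_one_eq (B : M4) (u : Fin 2 → ZMod 4) :
    (((B - 1) *ᵥ u) 0, ((B - 1) *ᵥ u) 1) = Nvec (tup B) (u 0, u 1) := by
  obtain ⟨h0, h1⟩ := mulVec_sub_one_eq_Nvec B u
  rw [h0, h1]

/-- Transfer of the «image has exactly two elements» property from the matrix `B − 1` on `(ℤ/4)²` to tuple coordinates. -/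
private theorem Nvec_props_of_mulVec (B : M4)
    (hex : ∃ u : Fin 2 → ZMod 4, (B - 1) *ᵥ u ≠ 0)
    (hall : ∀ u u' : Fin 2 → ZMod 4, (B - 1) *ᵥ u = 0 ∨ (B - 1) *ᵥ u' = 0 ∨ (B - 1) *ᵥ u = (B - 1) *ᵥ u') :
    (∃ u : ZMod 4 × ZMod 4, Nvec (tup B) u ≠ 0) ∧
      ∀ u u' : ZMod 4 × ZMod 4, Nvec (tup B) u = 0 ∨ Nvec (tup B) u' = 0 ∨ Nvec (tup B) u = Nvec (tup B) u' := by
  have key : ∀ u : Fin 2 → ZMod 4, Nvec (tup B) (u 0, u 1) = (((B - 1) *ᵥ u) 0, ((B - 1) *ᵥ u) 1) :=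
    fun u ↦ (mulVec_sub_one_eq B u).symm
  have zero_iff : ∀ u : Fin 2 → ZMod 4, (B - 1) *ᵥ u = 0 ↔ Nvec (tup B) (u 0, u 1) = 0 := by
    intro u; rw [key, vec_eq_iff]; rfl
  have eq_iff : ∀ u u' : Fin 2 → ZMod 4, (B - 1) *ᵥ u = (B - 1) *ᵥ u' ↔
      Nvec (tup B) (u 0, u 1) = Nvec (tup B) (u' 0, u' 1) := by
    intro u u'; rw [key, key, vec_eq_iff]
  -- every pair `(x, y)` is `(u 0, u 1)` for `u = ![x, y]`
  have lift : ∀ w : ZMod 4 × ZMod 4, ∃ u : Fin 2 → ZMod 4, (u 0, u 1) = w :=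
    fun w ↦ ⟨![w.1, w.2], rfl⟩
  refine ⟨?_, ?_⟩
  · obtain ⟨u, hu⟩ := hex
    exact ⟨(u 0, u 1), fun h ↦ hu ((zero_iff u).mpr h)⟩
  · intro w w'
    obtain ⟨u, rfl⟩ := lift w
    obtain ⟨u', rfl⟩ := lift w'
    rcases hall u u' with h | h | h
    · exact Or.inl ((zero_iff u).mp h)
    · exact Or.inr (Or.inl ((zero_iff u').mp h))
    · exact Or.inr (Or.inr ((eq_iff u u').mp h))

/-- Conjugation transport: the two-element-image property of `A − 1` passes to `kAk⁻¹ − 1`. -/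
private theorem props_conj (k A : M4) (hk : k.det * k.det = 1)
    (hex : ∃ u : Fin 2 → ZMod 4, (A - 1) *ᵥ u ≠ 0)
    (hall : ∀ u u' : Fin 2 → ZMod 4, (A - 1) *ᵥ u = 0 ∨ (A - 1) *ᵥ u' = 0 ∨ (A - 1) *ᵥ u = (A - 1) *ᵥ u') :
    (∃ u : Fin 2 → ZMod 4, (k * A * inv' k - 1) *ᵥ u ≠ 0) ∧
      ∀ u u' : Fin 2 → ZMod 4, (k * A * inv' k - 1) *ᵥ u = 0 ∨ (k * A * inv' k - 1) *ᵥ u' = 0 ∨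
        (k * A * inv' k - 1) *ᵥ u = (k * A * inv' k - 1) *ᵥ u' := by
  have hconj : k * A * inv' k - 1 = k * (A - 1) * inv' k := by
    rw [Matrix.mul_sub, Matrix.sub_mul, Matrix.mul_one, mul_inv' hk]
  have happly : ∀ u, (k * A * inv' k - 1) *ᵥ u = k *ᵥ ((A - 1) *ᵥ (inv' k *ᵥ u)) := by
    intro u; rw [hconj, Matrix.mulVec_mulVec, Matrix.mulVec_mulVec]
  have hkinj : ∀ v : Fin 2 → ZMod 4, k *ᵥ v = 0 → v = 0 := by
    intro v hv
    have h := congrArg (fun w ↦ inv' k *ᵥ w) hv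
    simp only [Matrix.mulVec_mulVec, inv'_mul hk, Matrix.one_mulVec, Matrix.mulVec_zero] at h
    exact h
  have hkinj' : ∀ v w : Fin 2 → ZMod 4, k *ᵥ v = k *ᵥ w → v = w := by
    intro v w h
    have h' : k *ᵥ (v - w) = 0 := by rw [Matrix.mulVec_sub, h, sub_self]
    exact sub_eq_zero.mp (hkinj _ h')
  refine ⟨?_, ?_⟩
  · obtain ⟨u₀, hu₀⟩ := hex
    refine ⟨k *ᵥ u₀, ?_⟩
    have hback : inv' k *ᵥ (k *ᵥ u₀) = u₀ := by rw [Matrix.mulVec_mulVec, inv'_mul hk, Matrix.one_mulVec]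
    rw [happly, hback]
    exact fun h ↦ hu₀ (hkinj _ h)
  · intro u u'
    rw [happly u, happly u']
    rcases hall (inv' k *ᵥ u) (inv' k *ᵥ u') with h | h | h
    · exact Or.inl (by rw [h, Matrix.mulVec_zero])
    · exact Or.inr (Or.inl (by rw [h, Matrix.mulVec_zero]))
    · exact Or.inr (Or.inr (by rw [h]))

omit [W.IsGloballyMinimal] in
/-- `#E[4] = 16` (frame `E[4] ≃+ (ℤ/4)²`). -/
theorem natCard_geomTorsion_four : Nat.card (geomTorsion W 4) = 16 := by
  rw [Nat.card_congr (LevelFour.frame4 W two_ne_zero).toEquiv, Nat.card_eq_fintype_card]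
  rfl

/-- ★★ **K81-D.** For `E/ℚ` (globally minimal) good supersingular at `2` with `ρ_{E,2^∞}` not onto, and any `σ ∈ Γ_ℚ` fixing the
fourth roots of unity, `#(E[4]/(σ−1)E[4]) ≠ 8`.  Consequently `T₂E/(σ−1)T₂E ≇ ℤ₂ ⊕ ℤ/2` for `σ ∈ G_{ℚ(μ_{2^∞})}` (reduce
mod `4`), and with K81 the minimal defect of a Chebotarev element for an Euler-system argument at `2` on the D–D locus is `4`.
[cite: DokchitserDokchitserMathZ2012, Theorem (2) and Lemma (p. 962)] [cite: Kato2004, Thm. 13.4 (3)] -/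
theorem natCard_quotient_range_sub_one_ne_eight (hss : GoodSS W 2) (hns : ¬ TwoAdicSurjective W)
    (σ : Field.absoluteGaloisGroup ℚ)
    (hσ : ∀ ζ : AlgebraicClosure ℚ, ζ ^ 4 = 1 → Field.absoluteGaloisGroup.toAlgEquiv ℚ σ ζ = ζ) :
    Nat.card (geomTorsion W 4 ⧸
      ((Multiplicative.toAdd (galoisRepTorsion W 4 σ)).toAddMonoidHom - AddMonoidHom.id (geomTorsion W 4)).range) ≠ 8 := by
  intro h8
  have h2Q : (2 : ℚ) ≠ 0 := two_ne_zero
  obtain ⟨A, hA⟩ : ∃ A : M4, A = LevelFour.M W h2Q σ := ⟨_, rfl⟩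
  -- (1) `det ρ̄₄(σ) = 1` (as in K81: `σ` fixes `ζ = e₄(P₀, Q₀)`)
  have hdet : A.det = 1 := by
    have hfix : σ • LevelFour.zeta W h2Q = LevelFour.zeta W h2Q := by
      rw [absoluteGaloisGroup.smul_def]
      exact hσ _ (LevelFour.zeta_pow_four W h2Q)
    rw [LevelFour.smul_zeta W h2Q σ, ← hA] at hfix
    have hsq := LevelFour.zeta_sq W h2Q
    have hd : A.det = 1 ∨ A.det = 3 := by
      have h : A.det * A.det = 1 := by
        rw [hA]; exact (det_sq (rhoMat W (LevelFour.frame4 W h2Q)) σ).1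
      revert h; generalize A.det = d; revert d; decide
    rcases hd with h | h
    · exact h
    · exfalso
      rw [h, show (3 : ZMod 4).val = 3 from rfl, pow_succ, hsq] at hfix
      have hz0 : LevelFour.zeta W h2Q = 0 := by
        have h2z : (2 : AlgebraicClosure ℚ) * LevelFour.zeta W h2Q = 0 := by linear_combination -hfix
        exact (mul_eq_zero.mp h2z).resolve_left two_ne_zero
      rw [hz0] at hsq
      norm_num at hsq
  -- (2) `#R = 2` where `R = (σ − 1)E[4]`, hence `R = {0, w}`
  set f : geomTorsion W 4 →+ geomTorsion W 4 :=
    (Multiplicative.toAdd (galoisRepTorsion W 4 σ)).toAddMonoidHom - AddMonoidHom.id (geomTorsion W 4) with hf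
  set R : AddSubgroup (geomTorsion W 4) := f.range with hR
  have hR2 : Nat.card R = 2 := by
    have hL := AddSubgroup.card_eq_card_quotient_mul_card_addSubgroup R
    rw [natCard_geomTorsion_four, h8] at hL
    omega
  obtain ⟨w, hw, hwu⟩ := (Nat.card_eq_two_iff' (0 : R)).mp hR2
  have hPex : ∃ P : geomTorsion W 4, f P ≠ 0 := by
    obtain ⟨P, hP⟩ := AddMonoidHom.mem_range.mp w.2
    refine ⟨P, fun h0 ↦ hw (Subtype.ext ?_)⟩
    rw [← hP, h0]; rfl
  have hPall : ∀ P Q : geomTorsion W 4, f P = 0 ∨ f Q = 0 ∨ f P = f Q := by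
    intro P Q
    by_cases hP : f P = 0
    · exact Or.inl hP
    by_cases hQ : f Q = 0
    · exact Or.inr (Or.inl hQ)
    refine Or.inr (Or.inr ?_)
    have hP' : (⟨f P, ⟨P, rfl⟩⟩ : R) = w := hwu _ (fun h ↦ hP (congrArg Subtype.val h))
    have hQ' : (⟨f Q, ⟨Q, rfl⟩⟩ : R) = w := hwu _ (fun h ↦ hQ (congrArg Subtype.val h))
    exact congrArg Subtype.val (hP'.trans hQ'.symm)
  -- (3) coordinates: `e ∘ f = (A − 1) *ᵥ ∘ e`
  set e : geomTorsion W 4 ≃+ (Fin 2 → ZMod 4) := LevelFour.frame4 W h2Q with he_def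
  have hmv : ∀ P : geomTorsion W 4, e (σ • P) = A *ᵥ e P := fun P ↦ by
    rw [hA]; exact rhoMat_mulVec W e σ P
  have hcoord : ∀ P : geomTorsion W 4, e (f P) = (A - 1) *ᵥ e P := by
    intro P
    rw [hf, AddMonoidHom.sub_apply, AddMonoidHom.id_apply, AddEquiv.coe_toAddMonoidHom, galoisRepTorsion_apply,
      map_sub, hmv, Matrix.sub_mulVec, Matrix.one_mulVec]
  have hexA : ∃ u : Fin 2 → ZMod 4, (A - 1) *ᵥ u ≠ 0 := by
    obtain ⟨P, hP⟩ := hPex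
    exact ⟨e P, fun h ↦ hP (e.injective (by rw [hcoord, h, map_zero]))⟩
  have hallA : ∀ u u' : Fin 2 → ZMod 4,
      (A - 1) *ᵥ u = 0 ∨ (A - 1) *ᵥ u' = 0 ∨ (A - 1) *ᵥ u = (A - 1) *ᵥ u' := by
    intro u u'
    have hu : (A - 1) *ᵥ u = e (f (e.symm u)) := by rw [hcoord, e.apply_symm_apply]
    have hu' : (A - 1) *ᵥ u' = e (f (e.symm u')) := by rw [hcoord, e.apply_symm_apply]
    rw [hu, hu']
    rcases hPall (e.symm u) (e.symm u') with h | h | h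
    · exact Or.inl (by rw [h, map_zero])
    · exact Or.inr (Or.inl (by rw [h, map_zero]))
    · exact Or.inr (Or.inr (by rw [h]))
  -- (4) conjugate into `ℍ` and decide
  obtain ⟨k, hk, hH⟩ := exists_conj_subset_HH_of_not_twoAdicSurjective W hss hns
  have hmem : tup (k * A * inv' k) ∈ HH := by rw [hA]; exact hH σ
  have hdet' : Q4.det (tup (k * A * inv' k)) = 1 := by rw [← det_eq, det_conj _ _ hk, hdet]
  obtain ⟨hex', hall'⟩ := props_conj k A hk hexA hallA
  obtain ⟨hexN, hallN⟩ := Nvec_props_of_mulVec (k * A * inv' k) hex' hall'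
  exact HH_image_sub_one_ne_two _ hmem hdet' hexN hallN

/-- K81-D in the shape of the typed candidate `K81GaloisLevel.NoOrderEightCokernelAtLevelFourOnDD` (v3 @2728a58c390d),
restated verbatim to stay import-free of Cruxes modules. -/
theorem noOrderEightCokernelAtLevelFourOnDD_holds :
    ∀ (W : WeierstrassCurve ℚ) [W.IsElliptic] [W.IsGloballyMinimal], GoodSS W 2 → ¬ TwoAdicSurjective W →
      ∀ σ : Field.absoluteGaloisGroup ℚ, (∀ ζ : AlgebraicClosure ℚ, ζ ^ 4 = 1 → Field.absoluteGaloisGroup.toAlgEquiv ℚ σ ζ = ζ) →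
        Nat.card (W.geomTorsion 4 ⧸
          ((Multiplicative.toAdd (W.galoisRepTorsion 4 σ)).toAddMonoidHom - AddMonoidHom.id (W.geomTorsion 4)).range) ≠ 8 :=
  fun V _ _ hss hns σ hσ ↦ natCard_quotient_range_sub_one_ne_eight V hss hns σ hσ

end Defect

end K81BigImLevelFour

end Summit.BirchSwinnertonDyer.BirchSwinnertonDyer.Cruxes.SupersingularRankZeroAtTwo

end
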